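import Summits.Schanuel.Schanuel.Theorems.RootDecomp1BFiniteOrderRadical01

/-!
# RootDecomp1BFiniteOrderRadical — lens 4, generation 34 «FINITE-ORDER NESTERENKO STOREY» (X(2) at (π, ρπ) for every ρ of exponential Liouville order 57) — continuation (RootDecomp1BFiniteOrderRadical02): §A the DERIVED measure (31): `logSize_ramanujanPoint_of (h51) (h411)`, `logSizeMeasure_nesterenkoPoint`, `logSizeMeasure_nesterenkoTriple_of (h11) (h51) (h411)`; §B estimates `mvPolyHeight_le_mvlen`, `logSize_lower_bound`, `finiteOrder_clash`

(lens-4 g34 `FiniteOrderRadical.lean`, sha256 721281aa…4b53, own farm rc 0 · 0 sorry · axioms std; critic VERDICT STATUS L1761 (credit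
B-R21 (d), PORT GO LOW); port by census-1 gen 16 in parts `RootDecomp1BFiniteOrderRadical01`–`05` (+ `06` hypothesis-free when the farm builds the
`_holds` cone) — see the PORT NOTE of part 01; `--supports stmt-Schanuel-24622`; rung 0.)
-/

noncomputable section

open Complex

namespace Summit.Schanuel.Schanuel.Theorems.RootDecomp1BFiniteOrderRadical

section Measure

open MvPolynomial IntermediateField
open Literature.NumberTheory.Transcendental (mvPolyHeight)
open Literature.NumberTheory.Transcendental.PhilipponMain (one_le_mvPolyHeight mem_coneIdeal_iff_of_isHomogeneous)
open Literature.NumberTheory.Transcendental.Nesterenko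
open Literature.Barriers.Schanuel

attribute [local instance] MvPolynomial.gradedAlgebra

variable {n : ℕ}

set_option maxHeartbeats 400000 in
/-- **(31) of LNM 1752 Ch. 3 (p. 47), DERIVED** — at every `q`, `0 < |q| < 1`, with `trdeg_ℚ ℚ(q, P(q), Q(q), R(q)) ≤ 3`,
there is `c > 0` with `exp(−c T⁴ (log T)²⁴) ≤ |B(q, P(q), Q(q), R(q))|` for every integer polynomial `B` in four
variables NOT VANISHING at the point and every `T ≥ max(deg B + log H(B), e)` (`H(B)` = `mvPolyHeight B` = max modulus
of the coefficients).  Proof = the proof of Cor. 5.2 printed on p. 47 minus its last (norm) step: homogenise `B` to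
`E ∉ 𝔭 = 𝔭_ω̄` (`𝔭` the prime homogeneous ideal of the line through `ω̄ = (1, q, P, Q, R)`, of rank `r ≤ 4` since
`trdeg ≤ 3`, with `|𝔭(ω̄)| = 0` by Cor. 4.10, tree PROVED); Prop. 4.11 (by name, `h411`) gives `J` of rank `r − 1`
with `|J(ω̄)| ≤ δ·e^{…} ≤ |B(ω)| e^{C₁ T}` (or `1 ≤ δ e^{…}` if `r = 1`); Theorem 5.1 (by name, `h51`) bounds `|J(ω̄)|`
below by `exp(−μ T'^{4/(4−s)} (log T')^{8s/(4−s)})`, `s = r − 1 ≤ 3`, `T' = C₂ T`, and `4/(4−s) ≤ 4`,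
`8s/(4−s) ≤ 24`.  INPUTS BY NAME: `h51 : NesterenkoPhilippon2001_ch3_thm_5_1` and
`h411 : NesterenkoPhilippon2001_ch3_prop_4_11` — both registered Literature facts PROVED in the tree
(`NesterenkoPhilippon2001_ch3_thm_5_1_holds`, `…_prop_4_11_holds`; their modules are outside this file's import
cone only because the farm snapshot has them unbuilt today). -/
theorem logSize_ramanujanPoint_of (h51 : NesterenkoPhilippon2001_ch3_thm_5_1)
    (h411 : NesterenkoPhilippon2001_ch3_prop_4_11) {q : ℂ} (hq0 : 0 < ‖q‖) (hq1 : ‖q‖ < 1)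
    (hK : Algebra.trdeg ℚ ↥(adjoin ℚ ({q, ramanujanP q, ramanujanQ q, ramanujanR q} : Set ℂ)) ≤ 3) :
    ∃ c : ℝ, 0 < c ∧ ∀ B : MvPolynomial (Fin 4) ℤ, MvPolynomial.aeval (ramanujanPoint q) B ≠ 0 →
      ∀ T : ℝ, max ((B.totalDegree : ℝ) + Real.log (mvPolyHeight B)) (Real.exp 1) ≤ T →
        Real.exp (-(c * T ^ 4 * Real.log T ^ 24)) ≤ ‖MvPolynomial.aeval (ramanujanPoint q) B‖ := by
  classical
  -- the point `ω̄`, its ideal `𝔭` and the rank `r`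
  set ω : Fin 5 → ℂ := nesterenkoOmega q with hω
  have hω0 : ω ≠ 0 := nesterenkoOmega_ne_zero q
  have hω1 : 1 ≤ ‖ω‖ := one_le_norm_nesterenkoOmega q
  have hωpt : ramanujanPoint q = fun i : Fin 4 => ω i.succ := ramanujanPoint_eq_nesterenkoOmega_succ q
  set 𝔭 : Ideal (Rx 4) := coneIdeal ω with h𝔭
  have h𝔭p : 𝔭.IsPrime := isPrime_coneIdeal ω
  have h𝔭h : 𝔭.IsHomogeneous (homogeneousSubmodule (Fin 5) ℚ) := isHomogeneous_coneIdeal ω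
  obtain ⟨r, hr1, hr4, hdim⟩ := exists_rank_coneIdeal q hK
  have hunm : IsUnmixedOfRank 𝔭 r := isUnmixedOfRank_of_isPrime h𝔭p hdim
  have hiabs : iabs 𝔭 r ω = 0 := by
    refine le_antisymm ?_ (iabs_nonneg _ _ _)
    have h := NesterenkoPhilippon2001_ch3_cor_4_10_holds 4 r 𝔭 hr1 hr4 h𝔭p h𝔭h hunm ω hω0
    rwa [rho_coneIdeal hω0, zero_mul] at h
  -- Theorem 5.1 at rank `max (r − 1) 1`
  obtain ⟨μ, hμ, H51⟩ := h51 q hq0 hq1 (max (r - 1) 1) (le_max_right _ _)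
    (max_le (by omega) (by norm_num))
  -- constants
  set D : ℝ := (ideg 𝔭 r : ℝ) with hD
  set h : ℝ := iheight 𝔭 r with hh
  have hD0 : 0 ≤ D := Nat.cast_nonneg _
  have hh0 : 0 ≤ h := height_nonneg _
  set C₁ : ℝ := D + h + 176 * D with hC₁
  set C₂ : ℝ := 1 + h + 22 * D with hC₂
  have hC₁0 : 0 ≤ C₁ := by rw [hC₁]; positivity
  have hC₂1 : 1 ≤ C₂ := by rw [hC₂]; linarith
  have hC₂0 : 0 < C₂ := by linarith
  have hlC₂ : 0 ≤ Real.log C₂ := Real.log_nonneg hC₂1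
  set c : ℝ := μ * C₂ ^ 4 * (Real.log C₂ + 1) ^ 24 + C₁ + 1 with hc
  have hμC : 0 ≤ μ * C₂ ^ 4 * (Real.log C₂ + 1) ^ 24 := by positivity
  have hcC₁ : C₁ ≤ c := by rw [hc]; linarith
  have hc0 : 0 < c := by rw [hc]; linarith
  refine ⟨c, hc0, fun B hBω T hT => ?_⟩
  have hB0 : B ≠ 0 := by rintro rfl; exact hBω (map_zero _)
  -- sizes
  have hTe : Real.exp 1 ≤ T := (le_max_right _ _).trans hT
  have hT1 : 1 ≤ T := by linarith [Real.add_one_le_exp (1 : ℝ)]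
  have hT0 : 0 < T := by linarith
  have hlogT1 : 1 ≤ Real.log T := by rw [Real.le_log_iff_exp_le hT0]; exact hTe
  have hH1 : (1 : ℝ) ≤ mvPolyHeight B := by exact_mod_cast one_le_mvPolyHeight hB0
  have hlogH0 : 0 ≤ Real.log (mvPolyHeight B) := Real.log_nonneg hH1
  have hd0 : (0 : ℝ) ≤ B.totalDegree := Nat.cast_nonneg _
  have hdT : (B.totalDegree : ℝ) ≤ T := by linarith [(le_max_left _ _).trans hT]
  have hlogHT : Real.log (mvPolyHeight B) ≤ T := by linarith [(le_max_left _ _).trans hT]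
  have hTpow : T ≤ T ^ 4 * Real.log T ^ 24 := by
    calc T = T * 1 := (mul_one T).symm
      _ ≤ T ^ 4 * Real.log T ^ 24 :=
          mul_le_mul (le_self_pow₀ hT1 (by norm_num)) (one_le_pow₀ hlogT1) zero_le_one (by positivity)
  have hTL0 : 0 ≤ T ^ 4 * Real.log T ^ 24 := by positivity
  have hgoal_of : ∀ X : ℝ, X ≤ c * (T ^ 4 * Real.log T ^ 24) →
      Real.exp (-X) ≤ ‖MvPolynomial.aeval (ramanujanPoint q) B‖ →
        Real.exp (-(c * T ^ 4 * Real.log T ^ 24)) ≤ ‖MvPolynomial.aeval (ramanujanPoint q) B‖ :=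
    fun X hX hXB => le_trans (Real.exp_le_exp.2 (by rw [mul_assoc]; linarith)) hXB
  by_cases hd : B.totalDegree = 0
  · -- `B` is a non-zero constant: `|B(ω)| ≥ 1`
    have hBC : B = C (B.coeff 0) := totalDegree_eq_zero_iff_eq_C.mp hd
    have hc0 : B.coeff 0 ≠ 0 := fun h0 => hB0 (by rw [hBC, h0, C_0])
    have hval : MvPolynomial.aeval (ramanujanPoint q) B = ((B.coeff 0 : ℤ) : ℂ) := by
      conv_lhs => rw [hBC]
      simp
    refine hgoal_of 0 (by positivity) ?_
    rw [neg_zero, Real.exp_zero, hval, Complex.norm_intCast]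
    exact_mod_cast Int.one_le_abs hc0
  · -- the main case `deg B = d ≥ 1`
    have hd1 : 1 ≤ B.totalDegree := Nat.one_le_iff_ne_zero.mpr hd
    set d : ℕ := B.totalDegree with hdd
    obtain ⟨E, hEhom, hEval, hEmax, hEht, hEne⟩ := Literature.Barriers.Schanuel.exists_homogenization B le_rfl
    have hE0 : E ≠ 0 := (hEne hB0).1
    have hEω : MvPolynomial.aeval ω E = MvPolynomial.aeval (ramanujanPoint q) B := by
      rw [hEval ω (by simp [hω, nesterenkoOmega]), hωpt]
    have hE𝔭 : E ∉ 𝔭 := fun hmem =>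
      hBω (by rw [← hEω]; exact (mem_coneIdeal_iff_of_isHomogeneous hEhom ω).1 hmem)
    have hmax1 : 1 ≤ maxNorm E := by rw [hEmax]; exact_mod_cast one_le_mvPolyHeight hB0
    have hnormAt : normAt ω E ≤ ‖MvPolynomial.aeval (ramanujanPoint q) B‖ := by
      rw [← hEω]; exact normAt_le_norm_aeval ω E hmax1 hω1
    have hδ : bezoutDelta 𝔭 r E ω ≤ ‖MvPolynomial.aeval (ramanujanPoint q) B‖ := by
      refine (bezoutDelta_le_max 𝔭 r E ω).trans (max_le hnormAt ?_)
      rw [hiabs]; exact norm_nonneg _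
    have hB0' : 0 ≤ ‖MvPolynomial.aeval (ramanujanPoint q) B‖ := norm_nonneg _
    have h411 := h411 4 r 𝔭 E d hr1 hr4 h𝔭p h𝔭h hunm hEhom hd1 hE𝔭
    -- the exponent of Prop. 4.11 3)
    set X : ℝ := height E * (ideg 𝔭 r : ℝ) + iheight 𝔭 r * (d : ℝ) +
      11 * ((4 : ℕ) : ℝ) ^ 2 * (ideg 𝔭 r : ℝ) * (d : ℝ) with hX
    have hhtE : height E ≤ T := hEht.trans hlogHT
    have hEx : X ≤ C₁ * T := by
      have h1 : height E * D ≤ T * D := mul_le_mul_of_nonneg_right hhtE hD0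
      have h2 : h * d ≤ h * T := mul_le_mul_of_nonneg_left hdT hh0
      have h3 : 176 * D * d ≤ 176 * D * T := mul_le_mul_of_nonneg_left hdT (by positivity)
      rw [hX, ← hD, ← hh, hC₁]; push_cast; norm_num; linarith
    have hExc : X ≤ c * (T ^ 4 * Real.log T ^ 24) :=
      hEx.trans ((mul_le_mul_of_nonneg_right hcC₁ hT0.le).trans (mul_le_mul_of_nonneg_left hTpow hc0.le))
    by_cases hr : r = 1
    · -- rank one: Prop. 4.11 (ii): `1 ≤ δ e^{…} ≤ |B(ω)| e^{…}`
      have h1 := (h411.2 hr) ω hω0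
      refine hgoal_of _ hExc ?_
      have h2 := h1.trans (mul_le_mul_of_nonneg_right hδ (Real.exp_pos _).le)
      have h3 := mul_le_mul_of_nonneg_left h2 (Real.exp_pos (-X)).le
      rw [mul_one, mul_left_comm, ← Real.exp_add, neg_add_cancel, Real.exp_zero, mul_one] at h3
      exact h3
    · -- rank `r ≥ 2`: Prop. 4.11 (i) and Theorem 5.1 at rank `s = r − 1`
      have hr2 : 2 ≤ r := by omega
      have hs : max (r - 1) 1 = r - 1 := max_eq_left (by omega)
      rw [hs] at H51
      set s : ℕ := r - 1 with hsdef
      have hs1 : (1 : ℝ) ≤ s := by rw [hsdef]; exact_mod_cast (show 1 ≤ r - 1 by omega)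
      have hs3 : (s : ℝ) ≤ 3 := by rw [hsdef]; exact_mod_cast (show r - 1 ≤ 3 by omega)
      obtain ⟨J, hJhom, hJunm, -, hJdeg, hJht, hJabs⟩ := h411.1 hr2
      have hchain : iabs J s ω ≤ ‖MvPolynomial.aeval (ramanujanPoint q) B‖ * Real.exp X :=
        (hJabs ω hω0).trans (mul_le_mul_of_nonneg_right hδ (Real.exp_pos _).le)
      -- `T' = C₂ T ≥ max(h(J) + deg J, e)`
      have hJdeg' : (ideg J s : ℝ) ≤ D * d := by rw [hD]; exact_mod_cast hJdeg
      have hr4' : (r : ℝ) ≤ 4 := by exact_mod_cast hr4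
      have hr5 : (r : ℝ) + 1 ≤ 5 := by linarith
      have hTC : T ≤ C₂ * T := le_mul_of_one_le_left hT0.le hC₂1
      have hT' : max (iheight J s + (ideg J s : ℝ)) (Real.exp 1) ≤ C₂ * T := by
        refine max_le ?_ (hTe.trans hTC)
        have h1 : h * d ≤ h * T := mul_le_mul_of_nonneg_left hdT hh0
        have h2 : height E * D ≤ T * D := mul_le_mul_of_nonneg_right hhtE hD0
        have h3 : (4 : ℝ) * (r + 1) * D * d ≤ 4 * 5 * D * T :=
          mul_le_mul (mul_le_mul_of_nonneg_right (by linarith) hD0) hdT hd0 (by positivity)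
        have h4 : D * d ≤ D * T := mul_le_mul_of_nonneg_left hdT hD0
        have hJht' : iheight J s ≤ h * d + height E * D + 4 * (r + 1) * D * d := by
          have := hJht; rw [← hD, ← hh] at this; push_cast at this; linarith
        rw [hC₂]; linarith
      have hlow := H51 J hJhom hJunm (C₂ * T) hT'
      -- exponent comparison
      have hCT1 : 1 ≤ C₂ * T := hT1.trans hTC
      have hCTe : Real.exp 1 ≤ C₂ * T := hTe.trans hTC
      have hCT0 : 0 < C₂ * T := by positivity
      have hlogCT1 : 1 ≤ Real.log (C₂ * T) := by rw [Real.le_log_iff_exp_le hCT0]; exact hCTe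
      have hlogCT0 : 0 ≤ Real.log (C₂ * T) := by linarith
      have h4s : 0 < (4 : ℝ) - s := by linarith
      have he₁ : (4 : ℝ) / (4 - s) ≤ 4 := by rw [div_le_iff₀ h4s]; linarith
      have he₂ : (8 : ℝ) * s / (4 - s) ≤ 24 := by rw [div_le_iff₀ h4s]; linarith
      have hpow1 : (C₂ * T) ^ ((4 : ℝ) / (4 - s)) ≤ (C₂ * T) ^ (4 : ℕ) := by
        have e : (C₂ * T) ^ ((4 : ℕ) : ℝ) = (C₂ * T) ^ (4 : ℕ) := Real.rpow_natCast _ _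
        rw [← e]; exact Real.rpow_le_rpow_of_exponent_le hCT1 (by exact_mod_cast he₁)
      have hpow2 : Real.log (C₂ * T) ^ ((8 : ℝ) * s / (4 - s)) ≤ Real.log (C₂ * T) ^ (24 : ℕ) := by
        have e : Real.log (C₂ * T) ^ ((24 : ℕ) : ℝ) = Real.log (C₂ * T) ^ (24 : ℕ) := Real.rpow_natCast _ _
        rw [← e]; exact Real.rpow_le_rpow_of_exponent_le hlogCT1 (by exact_mod_cast he₂)
      have hlogC : Real.log (C₂ * T) ≤ (Real.log C₂ + 1) * Real.log T := by
        have := mul_le_mul_of_nonneg_left hlogT1 hlC₂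
        rw [Real.log_mul hC₂0.ne' hT0.ne']; linarith
      have hmain : μ * (C₂ * T) ^ ((4 : ℝ) / (4 - s)) * Real.log (C₂ * T) ^ ((8 : ℝ) * s / (4 - s)) ≤
          μ * C₂ ^ 4 * (Real.log C₂ + 1) ^ 24 * (T ^ 4 * Real.log T ^ 24) := by
        calc μ * (C₂ * T) ^ ((4 : ℝ) / (4 - s)) * Real.log (C₂ * T) ^ ((8 : ℝ) * s / (4 - s))
            ≤ μ * (C₂ * T) ^ (4 : ℕ) * Real.log (C₂ * T) ^ (24 : ℕ) :=
              mul_le_mul (mul_le_mul_of_nonneg_left hpow1 hμ.le) hpow2 (Real.rpow_nonneg hlogCT0 _)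
                (by positivity)
          _ ≤ μ * (C₂ * T) ^ (4 : ℕ) * ((Real.log C₂ + 1) * Real.log T) ^ (24 : ℕ) := by
              gcongr
          _ = μ * C₂ ^ 4 * (Real.log C₂ + 1) ^ 24 * (T ^ 4 * Real.log T ^ 24) := by ring
      have hsum : μ * (C₂ * T) ^ ((4 : ℝ) / (4 - s)) * Real.log (C₂ * T) ^ ((8 : ℝ) * s / (4 - s)) + X ≤
            c * (T ^ 4 * Real.log T ^ 24) := by
        have h2 := hEx.trans (mul_le_mul_of_nonneg_left hTpow hC₁0)
        have e : c * (T ^ 4 * Real.log T ^ 24) = μ * C₂ ^ 4 * (Real.log C₂ + 1) ^ 24 * (T ^ 4 * Real.log T ^ 24) +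
            C₁ * (T ^ 4 * Real.log T ^ 24) + T ^ 4 * Real.log T ^ 24 := by rw [hc]; ring
        rw [e]; linarith
      refine hgoal_of _ hsum ?_
      rw [neg_add', Real.exp_sub, div_le_iff₀ (Real.exp_pos _)]
      exact hlow.trans hchain

/-- **(31) AT NESTERENKO'S POINT `(q₀, P(q₀), Q(q₀), R(q₀))`, `q₀ = e^{−2π}`** (checklist (0)): `∃ c > 0, ∀ B ∈ ℤ[x₁..x₄]`
with `B(ω) ≠ 0`, `∀ T ≥ max(deg B + log H(B), e)`: `exp(−c T⁴ (log T)²⁴) ≤ |B(ω)|`, `H = mvPolyHeight` (max modulus of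
the coefficients).  Inputs by name: Theorem 5.1 (`h51`), Proposition 4.11 (`h411`); `trdeg ≤ 3` here is ELEMENTARY
(`R(q₀) = 0`, tree PROVED). -/
theorem logSizeMeasure_nesterenkoPoint (h51 : NesterenkoPhilippon2001_ch3_thm_5_1)
    (h411 : NesterenkoPhilippon2001_ch3_prop_4_11) :
    ∃ c : ℝ, 0 < c ∧ ∀ B : MvPolynomial (Fin 4) ℤ, MvPolynomial.aeval (ramanujanPoint qN) B ≠ 0 →
      ∀ T : ℝ, max ((B.totalDegree : ℝ) + Real.log (mvPolyHeight B)) (Real.exp 1) ≤ T →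
        Real.exp (-(c * T ^ 4 * Real.log T ^ 24)) ≤ ‖MvPolynomial.aeval (ramanujanPoint qN) B‖ :=
  logSize_ramanujanPoint_of h51 h411 norm_qN_pos norm_qN_lt_one trdeg_adjoin_qN_le_three

/-- `(q₀, P(q₀), Q(q₀), R(q₀)) ∘ castSucc = (q₀, P(q₀), Q(q₀))`. -/
theorem ramanujanPoint_comp_castSucc : ramanujanPoint qN ∘ Fin.castSucc = nesterenkoTriple := by
  funext i
  fin_cases i <;> rfl

/-- Renaming variables injectively does not change `H`. -/
theorem mvPolyHeight_rename_of_injective {σ τ : Type*} {f : σ → τ} (hf : Function.Injective f)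
    (P : MvPolynomial σ ℤ) : mvPolyHeight (rename f P) = mvPolyHeight P := by
  classical
  unfold mvPolyHeight
  rw [support_rename_of_injective hf, Finset.sup_image]
  refine Finset.sup_congr rfl fun d _ => ?_
  simp only [Function.comp_apply, coeff_rename_mapDomain f hf]

/-- **THE LOG-SIZE MEASURE OF NESTERENKO'S TRIPLE: `LogSizeMeasure 4 24 (q₀, P(q₀), Q(q₀))`** — from the three
registered, tree-PROVED facts BY NAME: Nesterenko's Theorem 1.1 (`h11`, only to know that a non-zero `P ∈ ℤ[y₁, y₂, y₃]`
does not vanish at the triple), Theorem 5.1 (`h51`) and Proposition 4.11 (`h411`). -/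
theorem logSizeMeasure_nesterenkoTriple_of (h11 : nesterenko1996_thm_1_1)
    (h51 : NesterenkoPhilippon2001_ch3_thm_5_1) (h411 : NesterenkoPhilippon2001_ch3_prop_4_11) :
    LogSizeMeasure 4 24 nesterenkoTriple := by
  obtain ⟨c, hc, H⟩ := logSizeMeasure_nesterenkoPoint h51 h411
  have haiZ : AlgebraicIndependent ℤ nesterenkoTriple :=
    (algebraicIndependent_nesterenkoTriple h11).restrictScalars (algebraMap ℤ ℚ).injective_int
  refine ⟨c, hc, fun P hP0 t ht => ?_⟩
  have hval : MvPolynomial.aeval (ramanujanPoint qN) (rename Fin.castSucc P) =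
      MvPolynomial.aeval nesterenkoTriple P := by
    rw [MvPolynomial.aeval_rename, ramanujanPoint_comp_castSucc]
  have hne : MvPolynomial.aeval nesterenkoTriple P ≠ 0 := fun h0 =>
    hP0 ((algebraicIndependent_iff_injective_aeval.1 haiZ) (by rw [h0, map_zero]))
  have hB := H (rename Fin.castSucc P) (by rwa [hval]) t ?_
  · rwa [hval] at hB
  · refine le_trans (max_le_max ?_ le_rfl) ht
    have hdeg : ((rename Fin.castSucc P).totalDegree : ℝ) ≤ P.totalDegree := by
      exact_mod_cast totalDegree_rename_le _ _
    rw [mvPolyHeight_rename_of_injective (Fin.castSucc_injective 3)]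
    linarith

end Measure

/-! ## §B  The kernel over a log-size measure, at FINITE Liouville order -/

section Kernel

open MvPolynomial
open Literature.NumberTheory.Transcendental (mvPolyHeight)
open Literature.NumberTheory.Transcendental.PhilipponMain (one_le_mvPolyHeight)
open Summit.Schanuel.Schanuel.Theorems.RootDecomp1BRadicalDescent
open Summit.Schanuel.Schanuel.Theorems.RootDecomp1KHyper (mvlen mvlen_nonneg abs_coeff_le_mvlen one_le_mvlen
  exists_int_mul_eq_map mvaeval_int_map exists_ball_eval_ne_zero)
open Summit.Schanuel.Schanuel.Theorems.RootDecomp1KGeneric (LiouvilleOrder)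
open Summit.Schanuel.Schanuel.Theorems.RootDecomp1KHyper.HyperCell (natAbs_coeff_sup_le_mvlen)

variable {n : ℕ}

/-- `x^k ≤ exp (k x)` for `x ≥ 0`. -/
private theorem pow_le_exp_mul {x : ℝ} (hx : 0 ≤ x) (k : ℕ) : x ^ k ≤ Real.exp (k * x) := by
  rw [Real.exp_nat_mul]
  exact pow_le_pow_left₀ hx (by linarith [Real.add_one_le_exp x]) k

/-- `q ≤ exp q` for a natural number `q`. -/
private theorem natCast_le_exp (q : ℕ) : (q : ℝ) ≤ Real.exp q := by linarith [Real.add_one_le_exp (q : ℝ)]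

/-- `H(P) ≤ len P` in `ℝ` (`H` = `mvPolyHeight`, the maximum modulus of the coefficients; `len` = `mvlen`, their sum). -/
theorem mvPolyHeight_le_mvlen (P : MvPolynomial (Fin n) ℤ) : (mvPolyHeight P : ℝ) ≤ ((mvlen P : ℤ) : ℝ) := by
  have h := natAbs_coeff_sup_le_mvlen P
  rw [Int.cast_natCast] at h
  exact h

/-- **Step (3) of the kernel, standalone: the lower bound from a LOG-SIZE measure.** If `θ` satisfies the measure
inequality `exp(−c t^a (log t)^b) ≤ |P(θ)|` for `t ≥ max(deg P + log H(P), e)`, then for an integer polynomial `N ≠ 0`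
with `len N ≤ e^{q²} e^{c_E q²}` and `deg N ≤ q δ` one has `exp(−c_M q^{2(a+b)}) ≤ |N(θ)|`, `c_M = c (c_E + δ + 4)^{a+b}`
(take `t = (c_E + δ + 4) q²` and use `log t ≤ t`). -/
theorem logSize_lower_bound {a b : ℕ} {θ : Fin n → ℂ} {cμ : ℝ} (hcμ : 0 < cμ)
    (hMeas : ∀ P : MvPolynomial (Fin n) ℤ, P ≠ 0 → ∀ t : ℝ,
      max ((P.totalDegree : ℝ) + Real.log (mvPolyHeight P)) (Real.exp 1) ≤ t →
        Real.exp (-(cμ * t ^ a * Real.log t ^ b)) ≤ ‖MvPolynomial.aeval θ P‖)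
    {N : MvPolynomial (Fin n) ℤ} (hN0 : N ≠ 0) {q δe G : ℕ} {cE cT cM : ℝ}
    (hcE0 : 0 ≤ cE) (hcT : cT = cE + δe + 4) (hG : G = 2 * (a + b)) (hcM : cM = cμ * cT ^ (a + b))
    (hq2 : (1 : ℝ) ≤ (q : ℝ) ^ 2) (hqsq : (q : ℝ) ≤ (q : ℝ) ^ 2)
    (hlenq : ((mvlen N : ℤ) : ℝ) ≤ Real.exp ((q : ℝ) ^ 2) * Real.exp (cE * (q : ℝ) ^ 2))
    (hNdeg : (N.totalDegree : ℝ) ≤ (q : ℝ) * δe) :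
    Real.exp (-(cM * (q : ℝ) ^ G)) ≤ ‖MvPolynomial.aeval θ N‖ := by
  have hq20 : (0 : ℝ) ≤ (q : ℝ) ^ 2 := by positivity
  have hδ0 : (0 : ℝ) ≤ δe := Nat.cast_nonneg _
  have hcT4 : 4 ≤ cT := by rw [hcT]; linarith
  have hcT0 : 0 ≤ cT := by linarith
  -- log H(N) ≤ (1 + cE) q²
  have hH1 : (1 : ℝ) ≤ mvPolyHeight N := by exact_mod_cast one_le_mvPolyHeight hN0
  have hlogH : Real.log (mvPolyHeight N) ≤ (1 + cE) * (q : ℝ) ^ 2 := by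
    have h1 : (mvPolyHeight N : ℝ) ≤ Real.exp ((1 + cE) * (q : ℝ) ^ 2) := by
      refine ((mvPolyHeight_le_mvlen N).trans hlenq).trans (le_of_eq ?_)
      rw [← Real.exp_add]; ring_nf
    have h2 := Real.log_le_log (by linarith) h1
    rwa [Real.log_exp] at h2
  have hdeg : (N.totalDegree : ℝ) ≤ (δe : ℝ) * (q : ℝ) ^ 2 := by nlinarith
  -- the size parameter
  set t : ℝ := cT * (q : ℝ) ^ 2 with ht
  have ht4 : 4 ≤ t := by rw [ht]; nlinarith
  have hte : Real.exp 1 ≤ t := by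
    have := Real.exp_one_lt_d9; linarith
  have ht1 : 1 ≤ t := by linarith
  have ht0 : 0 < t := by linarith
  have hmax : max ((N.totalDegree : ℝ) + Real.log (mvPolyHeight N)) (Real.exp 1) ≤ t := by
    refine max_le ?_ hte
    rw [ht, hcT]; nlinarith
  have hmeas := hMeas N hN0 t hmax
  refine le_trans ?_ hmeas
  rw [Real.exp_le_exp, neg_le_neg_iff]
  have hlog0 : 0 ≤ Real.log t := Real.log_nonneg ht1
  have hlogt : Real.log t ≤ t := (Real.log_le_sub_one_of_pos ht0).trans (by linarith)
  calc cμ * t ^ a * Real.log t ^ b ≤ cμ * t ^ a * t ^ b := by gcongr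
    _ = cM * (q : ℝ) ^ G := by rw [hcM, hG, ht]; ring

/-- **Step (5) of the kernel, standalone: the polynomial clash.** For `q > c₃ = (K_L + 1) + c_U + c_M`, `q ≥ 1`,
`2 ≤ G`, `G + 1 ≤ m`: `(K_L + 1) e^{c_U q²} e^{−q^m} < e^{−c_M q^G}`. -/
theorem finiteOrder_clash {Kl cU cM c₃ q : ℝ} {G m : ℕ} (hKl : 0 ≤ Kl) (hcU : 0 ≤ cU) (hcM : 0 ≤ cM)
    (hc₃ : c₃ = (Kl + 1) + cU + cM) (hG : 2 ≤ G) (hm : G + 1 ≤ m) (hq1 : 1 ≤ q) (hq : c₃ < q) :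
    (Kl + 1) * Real.exp (cU * q ^ 2) * Real.exp (-(q ^ m)) < Real.exp (-(cM * q ^ G)) := by
  have hq0 : 0 ≤ q := by linarith
  have hqG : q ^ 2 ≤ q ^ G := pow_le_pow_right₀ hq1 hG
  have h1G : 1 ≤ q ^ G := one_le_pow₀ hq1
  have hG0 : 0 < q ^ G := by positivity
  have hqm : q * q ^ G ≤ q ^ m := by
    rw [← pow_succ']; exact pow_le_pow_right₀ hq1 hm
  have key : Kl + cU * q ^ 2 + cM * q ^ G < q ^ m := by
    have h1 : Kl ≤ Kl * q ^ G := le_mul_of_one_le_right hKl h1G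
    have h2 : cU * q ^ 2 ≤ cU * q ^ G := mul_le_mul_of_nonneg_left hqG hcU
    have h3 : (Kl + cU + cM + 1) * q ^ G ≤ q * q ^ G := by
      refine mul_le_mul_of_nonneg_right ?_ hG0.le; rw [hc₃] at hq; linarith
    nlinarith
  calc (Kl + 1) * Real.exp (cU * q ^ 2) * Real.exp (-(q ^ m))
      ≤ Real.exp Kl * Real.exp (cU * q ^ 2) * Real.exp (-(q ^ m)) := by
        gcongr; exact Real.add_one_le_exp Kl
    _ = Real.exp (Kl + cU * q ^ 2 - q ^ m) := by rw [← Real.exp_add, ← Real.exp_add]; ring_nf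
    _ < Real.exp (-(cM * q ^ G)) := Real.exp_lt_exp.2 (by linarith)

end Kernel

end Summit.Schanuel.Schanuel.Theorems.RootDecomp1BFiniteOrderRadical

end
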